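import Mathlib.RingTheory.Localization.AtPrime.Basic
import Mathlib.RingTheory.Localization.Ideal
import Mathlib.RingTheory.Ideal.Colon
import HarnessLib

/-!
# Door assembly H2c″, stub [S6] — kernel (6a-2): the `T`-saturation of `(T^a g₀)` in a local domain is `(g₀)`

Route `ResolutionOfSingularities/WeightedInvariant`, crux `Theses.WeightedInvariant.HypersurfaceCentreConstruction`
(stmt-ResolutionOfSingularities-19897), door line `local-engine`, skeleton v3.1, stub [S6] `stub_iotaMax_lt_of_step`
(holder res-L1-w43-stub-9 = res-D-brk-1; [S6] DECOMPOSITION of record, STATUS l.35153, kernel **(6a-2)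
`span_eq_saturation_of_prime`**, pure algebra, def-free, no stub identity).

In the strict-transform step of the [S6] proof the stalk of the strict transform at a point of the exceptional chart is the
`T`-saturation `Sat = {x | ∃ k, Tᵏ x ∈ (f)}` of the local equation `f = Tᵃ · g₀` (`T` the exceptional parameter, prime in
the chart algebra `C`, `T ∤ g₀`), read in the local ring `O = C_𝔫`; `Sat` is principal, `= (γ)`, because the strict
transform is locally principal. This file proves `(g₀/1) = (γ)`: `g₀/1 ∈ Sat` trivially, and if `Tᵏ γ = d f` then writing
`g₀/1 = c γ` gives `c (d Tᵃ) = Tᵏ` with `T ∤ c`, so `c` is a unit (`T` stays prime in `C_𝔫` since `T ∈ 𝔫`).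
* `isUnit_of_mul_eq_prime_pow` — `c d = pᵏ`, `p` prime, `p ∤ c` ⟹ `c` unit (domain);
* `prime_algebraMap_localization_atPrime` — a prime element of `𝔫` stays prime in `C_𝔫`;
* `not_dvd_algebraMap_localization_atPrime` — `T ∤ g₀` in `C` ⟹ `T/1 ∤ g₀/1` in `C_𝔫` (`T ∈ 𝔫` prime);
* `span_eq_saturation_of_prime` (membership form of `Sat`) and `span_eq_iSup_colon_of_prime` (`Sat = ⨆ k, (f) : Tᵏ`, Mathlib `Submodule.colon` by the singleton `{Tᵏ}`).
OURS; no claim about Hironaka's problem; AI-written, weaker than expert review.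
-/

set_option linter.dupNamespace false -- mandated namespace of this single-conjunct summit

namespace Summit.ResolutionOfSingularities.ResolutionOfSingularities.Cruxes.HypersurfaceCentreConstruction.LocalEngine


variable {C : Type*} [CommRing C]

/-- `c * d = p ^ k` with `p` prime and `p ∤ c` forces `c` to be a unit (in a domain: peel off one `p` at a time from `d`).
[folklore] -/
theorem isUnit_of_mul_eq_prime_pow [IsDomain C] {p c : C} (hp : Prime p) (hc : ¬ p ∣ c) :
    ∀ {k : ℕ} {d : C}, c * d = p ^ k → IsUnit c := by
  intro k
  induction k with
  | zero =>
    intro d h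
    rw [pow_zero] at h
    exact IsUnit.of_mul_eq_one d h
  | succ k ih =>
    intro d h
    have hpd : p ∣ c * d := ⟨p ^ k, by rw [h, pow_succ, mul_comm]⟩
    rcases hp.dvd_or_dvd hpd with hpc | ⟨d', rfl⟩
    · exact absurd hpc hc
    · refine ih (d := d') (mul_left_cancel₀ hp.ne_zero ?_)
      calc p * (c * d') = c * (p * d') := by ring
        _ = p ^ (k + 1) := h
        _ = p * p ^ k := by rw [pow_succ, mul_comm]

variable (𝔫 : Ideal C) [𝔫.IsPrime]

/-- The complement of a prime `𝔫` misses the principal ideal of any element of `𝔫`. [folklore] -/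
theorem disjoint_primeCompl_span_singleton {T : C} (hTn : T ∈ 𝔫) :
    Disjoint (𝔫.primeCompl : Set C) (Ideal.span {T}) := by
  rw [Set.disjoint_left]
  intro x hx hxT
  exact hx ((Ideal.span_singleton_le_iff_mem _).mpr hTn hxT)

/-- **A prime element of `𝔫` stays prime in `C_𝔫`** (its principal prime ideal misses the complement of `𝔫`).
[folklore] -/
theorem prime_algebraMap_localization_atPrime [IsDomain C] {T : C} (hT : Prime T) (hTn : T ∈ 𝔫) :
    Prime (algebraMap C (Localization.AtPrime 𝔫) T) := by
  have hinj : Function.Injective (algebraMap C (Localization.AtPrime 𝔫)) :=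
    IsLocalization.injective (Localization.AtPrime 𝔫) 𝔫.primeCompl_le_nonZeroDivisors
  have hprime : (Ideal.span {T}).IsPrime := (Ideal.span_singleton_prime hT.ne_zero).mpr hT
  have hP : (Ideal.span {algebraMap C (Localization.AtPrime 𝔫) T}).IsPrime := by
    have := IsLocalization.isPrime_of_isPrime_disjoint 𝔫.primeCompl (Localization.AtPrime 𝔫) (Ideal.span {T})
      hprime (disjoint_primeCompl_span_singleton 𝔫 hTn)
    rwa [Ideal.map_span, Set.image_singleton] at this
  have ht0 : algebraMap C (Localization.AtPrime 𝔫) T ≠ 0 := fun h0 => hT.ne_zero (hinj (h0.trans (map_zero _).symm))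
  exact (Ideal.span_singleton_prime ht0).mp hP

/-- **Non-divisibility by a prime element of `𝔫` persists in `C_𝔫`**: if `T ∤ g₀` in `C` then `T/1 ∤ g₀/1` (contract the
prime ideal `(T) C_𝔫` back to `C`). [folklore] -/
theorem not_dvd_algebraMap_localization_atPrime {T g₀ : C} (hT : Prime T) (hTn : T ∈ 𝔫) (hg : ¬ T ∣ g₀) :
    ¬ algebraMap C (Localization.AtPrime 𝔫) T ∣ algebraMap C (Localization.AtPrime 𝔫) g₀ := by
  rintro ⟨q, hq⟩
  apply hg
  have hprime : (Ideal.span {T}).IsPrime := (Ideal.span_singleton_prime hT.ne_zero).mpr hT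
  have hmem : algebraMap C (Localization.AtPrime 𝔫) g₀ ∈ (Ideal.span {T}).map (algebraMap C (Localization.AtPrime 𝔫)) := by
    rw [Ideal.map_span, Set.image_singleton, hq]
    exact Ideal.mul_mem_right _ _ (Ideal.subset_span rfl)
  have hunder := IsLocalization.under_map_of_isPrime_disjoint 𝔫.primeCompl (Localization.AtPrime 𝔫) hprime
    (disjoint_primeCompl_span_singleton 𝔫 hTn)
  have hg' : g₀ ∈ ((Ideal.span {T}).map (algebraMap C (Localization.AtPrime 𝔫))).under C := hmem
  rw [hunder, Ideal.mem_span_singleton] at hg'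
  exact hg'

/-- **(6a-2) The `T`-saturation of `(Tᵃ g₀)` in `C_𝔫` is `(g₀)`**, membership form. Data: `C` a domain, `𝔫` prime,
`T ∈ 𝔫` a prime element, `f = Tᵃ g₀` with `T ∤ g₀`, and `γ ∈ C_𝔫` generating the saturation
`{x | ∃ k, (T/1)ᵏ x ∈ (f/1)}`. Conclusion `(g₀/1) = (γ)`. [folklore] -/
theorem span_eq_saturation_of_prime [IsDomain C] {T g₀ f : C} (hT : Prime T) (hTn : T ∈ 𝔫) {a : ℕ}
    (hf : f = T ^ a * g₀) (hg : ¬ T ∣ g₀) (γ : Localization.AtPrime 𝔫)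
    (hsat : ∀ x : Localization.AtPrime 𝔫, x ∈ Ideal.span {γ} ↔
      ∃ k : ℕ, algebraMap C (Localization.AtPrime 𝔫) T ^ k * x ∈
        Ideal.span {algebraMap C (Localization.AtPrime 𝔫) f}) :
    Ideal.span {algebraMap C (Localization.AtPrime 𝔫) g₀} = Ideal.span {γ} := by
  set t : Localization.AtPrime 𝔫 := algebraMap C (Localization.AtPrime 𝔫) T with ht
  have hinj : Function.Injective (algebraMap C (Localization.AtPrime 𝔫)) :=
    IsLocalization.injective (Localization.AtPrime 𝔫) 𝔫.primeCompl_le_nonZeroDivisors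
  have htg : ¬ t ∣ algebraMap C (Localization.AtPrime 𝔫) g₀ := not_dvd_algebraMap_localization_atPrime 𝔫 hT hTn hg
  -- `g₀/1 ∈ (γ)`
  have h1 : algebraMap C (Localization.AtPrime 𝔫) g₀ ∈ Ideal.span {γ} := by
    rw [hsat]
    refine ⟨a, ?_⟩
    rw [ht, ← map_pow, ← map_mul, ← hf]
    exact Ideal.subset_span rfl
  obtain ⟨c, hc⟩ := Ideal.mem_span_singleton'.mp h1
  -- `γ ∈ Sat`: `tᵏ γ = d · f/1`
  obtain ⟨k, hk⟩ := (hsat γ).mp (Ideal.subset_span rfl)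
  obtain ⟨d, hd⟩ := Ideal.mem_span_singleton'.mp hk
  -- `g₀ ≠ 0` (as `T ∤ g₀`), hence `γ ≠ 0`
  have hg0 : algebraMap C (Localization.AtPrime 𝔫) g₀ ≠ 0 := by
    intro h0
    apply hg
    rw [(hinj (h0.trans (map_zero _).symm) : g₀ = 0)]
    exact dvd_zero T
  have hγ0 : γ ≠ 0 := by
    rintro rfl
    exact hg0 (by rw [← hc, mul_zero])
  have htc : ¬ t ∣ c := fun h => htg (hc ▸ Dvd.dvd.mul_right h γ)
  -- `c · (d tᵃ) = tᵏ`, so `c` is a unit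
  have key : c * (d * t ^ a) = t ^ k := by
    apply mul_right_cancel₀ hγ0
    calc c * (d * t ^ a) * γ = d * (t ^ a * (c * γ)) := by ring
      _ = d * algebraMap C (Localization.AtPrime 𝔫) f := by rw [hc, hf, map_mul, map_pow]
      _ = t ^ k * γ := hd
  have hcu : IsUnit c := isUnit_of_mul_eq_prime_pow (prime_algebraMap_localization_atPrime 𝔫 hT hTn) htc key
  apply le_antisymm
  · rw [Ideal.span_singleton_le_iff_mem]
    exact h1
  · rw [Ideal.span_singleton_le_iff_mem, Ideal.mem_span_singleton']
    obtain ⟨u, hu⟩ := hcu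
    exact ⟨↑u⁻¹, by rw [← hc, ← hu, ← mul_assoc, Units.inv_mul, one_mul]⟩

/-- Membership in the saturation ideal `⨆ k, (f) : tᵏ` is `∃ k, tᵏ x ∈ (f)` (an increasing union). [folklore] -/
theorem mem_iSup_colon_singleton_pow_iff {O : Type*} [CommRing O] (f t x : O) :
    x ∈ ⨆ k : ℕ, (Ideal.span {f}).colon {t ^ k} ↔ ∃ k : ℕ, t ^ k * x ∈ Ideal.span {f} := by
  have hmono : Monotone fun k : ℕ => (Ideal.span {f}).colon {t ^ k} := by
    intro k l hkl y hy
    rw [Submodule.mem_colon_singleton, smul_eq_mul] at hy ⊢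
    obtain ⟨m, rfl⟩ := Nat.exists_eq_add_of_le hkl
    rw [pow_add, ← mul_assoc]
    exact Ideal.mul_mem_right _ _ hy
  rw [Submodule.mem_iSup_of_directed _ hmono.directed_le]
  refine exists_congr fun k => ?_
  rw [Submodule.mem_colon_singleton, smul_eq_mul, mul_comm]

/-- **(6a-2), `⨆ colon` form**: with the saturation written as the ideal `⨆ k, (f/1) : (T/1)ᵏ`. [folklore] -/
theorem span_eq_iSup_colon_of_prime [IsDomain C] {T g₀ f : C} (hT : Prime T) (hTn : T ∈ 𝔫) {a : ℕ}
    (hf : f = T ^ a * g₀) (hg : ¬ T ∣ g₀) (γ : Localization.AtPrime 𝔫)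
    (hsat : ⨆ k : ℕ, (Ideal.span {algebraMap C (Localization.AtPrime 𝔫) f}).colon
        {algebraMap C (Localization.AtPrime 𝔫) T ^ k} = Ideal.span {γ}) :
    Ideal.span {algebraMap C (Localization.AtPrime 𝔫) g₀} = Ideal.span {γ} :=
  span_eq_saturation_of_prime 𝔫 hT hTn hf hg γ fun x => by
    rw [← hsat, mem_iSup_colon_singleton_pow_iff]


end Summit.ResolutionOfSingularities.ResolutionOfSingularities.Cruxes.HypersurfaceCentreConstruction.LocalEngine
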